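import Literature.AlgebraicGeometry.HodgeTheory.RationalClassesIndependent
import Literature.AlgebraicTopology.SingularHomology.CohomologyRingChange
import Mathlib.LinearAlgebra.Basis.VectorSpace
import Mathlib.LinearAlgebra.LinearIndependent.Lemmas
import HarnessLib

/-!
# Rational classes are the image of `Hᵏ(Y; ℚ) → Hᵏ(Y; ℂ)`; this map is injective, and so is
# `Hᵏ(Y; ℚ) ⊗ ℂ → Hᵏ(Y; ℂ)`

Family `hodge`, layer `Literature/AlgebraicGeometry/HodgeTheory`. Companion to `RationalHodgeClasses`
(`IsRationalClass c`: the class `c ∈ Hᵏ(Y; ℂ)` is represented by a singular cocycle with values in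
`ℚ ⊆ ℂ`, "i.e. `c` lies in the image of `Hᵏ(Y; ℚ) → Hᵏ(Y; ℂ)`") and to `RationalClassesIndependent`
(a finite family of rational classes with no rational relation is `ℂ`-independent). Here the map
`Hᵏ(Y; ℚ) → Hᵏ(Y; ℂ)` is taken to be the tree's change-of-coefficient-ring map on COHOMOLOGY,
`singularCohomology.ringChange (algebraMap ℚ ℂ) Y k : Hᵏ(Y; ℚ) →+ Hᵏ(Y; ℂ)`, `[u] ↦ [(ℚ ↪ ℂ) ∘ u]`
(`Literature.AlgebraicTopology.SingularHomology.CohomologyRingChange`; Hatcher 2002, §3.1 p. 198: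
a homomorphism of coefficient groups induces a cochain map and a map on cohomology), and everything
below is PROVED, for every topological space `Y` and every degree `k`, with an import cone free of
named facts:

* `isRationalClass_iff_exists_ringChange`: **`IsRationalClass c ↔ c = ι(x)` for some
  `x ∈ Hᵏ(Y; ℚ)`**, `ι = ringChange (algebraMap ℚ ℂ)` — the "i.e." of the docstring of
  `IsRationalClass` (a `ℚ`-valued `ℂ`-cocycle is `(ℚ ↪ ℂ) ∘ φ` for a `ℚ`-cochain `φ`, which is a
  cocycle because `δ` commutes with `ℚ ↪ ℂ` and `ℚ ↪ ℂ` is injective);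
* `ringChange_ratCast_smul`: `ι` is `ℚ`-linear (`ι(q • x) = q • ι(x)`);
* `ringChange_rat_injective`, `ringChange_rat_eq_zero_iff`: **`ι` is injective** (Hatcher, §3.1,
  Thm. 3.2 with p. 198: over a field `Hᵏ(Y; F) = Hom(Hₖ(Y), F)`; proved here on cochains: if
  `(ℚ ↪ ℂ) ∘ ζ = δw`, apply a `ℚ`-linear retraction `ρ : ℂ → ℚ` of the inclusion to the values of
  `w` — `δ` commutes with the additive map `ρ`, `coboundary_comp_addMonoidHom` — so `ζ = δ(ρ ∘ w)`);
* `linearIndependent_ringChange_iff`: **a family `x : ι → Hᵏ(Y; ℚ)` is `ℚ`-linearly independent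
  iff `ι ∘ x` is `ℂ`-linearly independent**, i.e. `Hᵏ(Y; ℚ) ⊗_ℚ ℂ → Hᵏ(Y; ℂ)` is injective
  (Voisin I, §7.1.1; from `linearIndependent_of_isRationalClass`);
* `span_ringChange_image_span`, `ringChange_mem_span_image_iff`: for a `ℚ`-subspace
  `V ⊆ Hᵏ(Y; ℚ)`, `ℂ · ι(V) ∩ ι(Hᵏ(Y; ℚ)) = ι(V)` — **a rational class lying in the `ℂ`-span of
  the image of `V` already lies in the image of `V`** (rational descent of linear relations; the
  form in which the comparison "`B`-algebraic / summit-algebraic" is used by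
  `Literature.AlgebraicGeometry.Motives.SummitCompatible`).

Not here: the finiteness of `Hᵏ(X(ℂ); ℚ)` for smooth projective `X` and the cocycle-level map
`HodgeTheory.cocycleOfRat` (both in `RationalLattice`, whose import cone is larger); the relation
`[cocycleOfRat ζ] = ι [ζ]` is recorded next to the users of both.

## References

* A. Hatcher, *Algebraic Topology* (2002), §3.1 (cochains, `δ`, p. 198 change of coefficients),
  Thm. 3.2.
* C. Voisin, *Hodge Theory and Complex Algebraic Geometry I* (2002), §7.1.1.
-/

noncomputable section

open CategoryTheory

universe u v

namespace Literature.AlgebraicGeometry.HodgeTheory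

section HodgeTheory

open Literature.AlgebraicTopology.SingularHomology singularCochainComplex

variable {Y : Type u} [TopologicalSpace Y] {k : ℕ}

/-! ### Cochain level: `δ` commutes with post-composition by an additive map -/

/-- `δ(g ∘ φ) = g ∘ δφ` for an ADDITIVE map `g : R → S` of coefficient rings (not necessarily a
ring homomorphism): `δφ(σ) = ∑ (-1)ⁱ φ(σ ∘ δᵢ)` is a signed sum of values (Hatcher 2002, §3.1,
p. 198: a homomorphism of coefficient groups induces a cochain map). [cite: HatcherAT2002, §3.1 p. 198] -/
theorem coboundary_comp_addMonoidHom {R S : Type v} [CommRing R] [CommRing S] (g : R →+ S) {m : ℕ}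
    (φ : SingularSimplex Y m → R) : coboundary m (g ∘ φ) = g ∘ coboundary m φ := by
  funext σ
  rw [coboundary_eq, coboundary_eq, singularCochainComplex.d_apply, Function.comp_apply,
    singularCochainComplex.d_apply, map_sum]
  refine Finset.sum_congr rfl fun i _ ↦ ?_
  rcases Nat.even_or_odd (i : ℕ) with h | h
  · rw [h.neg_one_pow, h.neg_one_pow, one_smul, one_smul]
    rfl
  · rw [h.neg_one_pow, h.neg_one_pow, neg_one_smul, neg_one_smul, Function.comp_apply, map_neg]

/-! ### Rational classes = image of `Hᵏ(Y; ℚ) → Hᵏ(Y; ℂ)` -/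

/-- The image `ι(x) ∈ Hᵏ(Y; ℂ)` of a rational cohomology class `x ∈ Hᵏ(Y; ℚ)` under the change of
coefficients `ι = ringChange (ℚ ↪ ℂ)` is a rational class: it is represented by the cocycle
`(ℚ ↪ ℂ) ∘ ζ` for a representative `ζ` of `x`, whose values are rational.
[cite: HatcherAT2002, §3.1 p. 198] -/
theorem isRationalClass_ringChange (x : singularCohomology ℚ ℚ Y k) :
    IsRationalClass (singularCohomology.ringChange (algebraMap ℚ ℂ) Y k x) := by
  induction x using singularCohomology_induction_on with
  | h ζ =>
    refine ⟨cocyclesRingChange (algebraMap ℚ ℂ) k ζ, (singularCohomology.ringChange_π _ ζ).symm,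
      fun σ ↦ ⟨coFn ζ σ, ?_⟩⟩
    change algebraMap ℚ ℂ (coFn ζ σ) = coFn (cocyclesRingChange (algebraMap ℚ ℂ) k ζ) σ
    rw [coFn_cocyclesRingChange]
    rfl

/-- Conversely **a rational class is `ι(x)` for some `x ∈ Hᵏ(Y; ℚ)`**: a `ℂ`-cocycle `z` with
rational values is `(ℚ ↪ ℂ) ∘ φ` for the `ℚ`-cochain `φ` of its values, and `φ` is a cocycle because
`(ℚ ↪ ℂ) ∘ δφ = δ((ℚ ↪ ℂ) ∘ φ) = δz = 0` and `ℚ ↪ ℂ` is injective (Hatcher 2002, §3.1).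
[cite: HatcherAT2002, §3.1 p. 198] -/
theorem IsRationalClass.exists_ringChange_eq {c : singularCohomology ℂ ℂ Y k}
    (hc : IsRationalClass c) :
    ∃ x : singularCohomology ℚ ℚ Y k, singularCohomology.ringChange (algebraMap ℚ ℂ) Y k x = c := by
  obtain ⟨z, rfl, hz⟩ := hc
  choose φ hφ using hz
  have hφz : (algebraMap ℚ ℂ) ∘ φ = coFn z := funext hφ
  have hdφ : (singularCochainComplex ℚ ℚ Y).d k (k + 1) φ = 0 := by
    have h1 : (algebraMap ℚ ℂ) ∘ coboundary k φ = 0 := by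
      rw [← coboundary_comp_ringHom, hφz, coboundary_coFn]
    change coboundary k φ = 0
    funext σ
    apply (algebraMap ℚ ℂ).injective
    rw [Pi.zero_apply, map_zero]
    exact congrFun h1 σ
  refine ⟨singularCohomology.π ℚ ℚ Y k (cocyclesMk φ hdφ), ?_⟩
  rw [singularCohomology.ringChange_π]
  congr 1
  exact coFn_injective (by rw [coFn_cocyclesRingChange, coFn_cocyclesMk, hφz])

/-- **`IsRationalClass c ↔ c` lies in the image of `Hᵏ(Y; ℚ) → Hᵏ(Y; ℂ)`** (the "i.e." of the
docstring of `IsRationalClass`), the map being the change of coefficients on cohomology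
`ι = singularCohomology.ringChange (algebraMap ℚ ℂ) Y k`. [cite: HatcherAT2002, §3.1 p. 198] -/
theorem isRationalClass_iff_exists_ringChange (c : singularCohomology ℂ ℂ Y k) :
    IsRationalClass c ↔
      ∃ x : singularCohomology ℚ ℚ Y k, singularCohomology.ringChange (algebraMap ℚ ℂ) Y k x = c :=
  ⟨IsRationalClass.exists_ringChange_eq, fun ⟨x, hx⟩ ↦ hx ▸ isRationalClass_ringChange x⟩

/-- The set of rational classes of `Hᵏ(Y; ℂ)` is the range of `ι : Hᵏ(Y; ℚ) → Hᵏ(Y; ℂ)`.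
[cite: HatcherAT2002, §3.1 p. 198] -/
theorem setOf_isRationalClass_eq_range :
    {c : singularCohomology ℂ ℂ Y k | IsRationalClass c} =
      Set.range (singularCohomology.ringChange (algebraMap ℚ ℂ) Y k) :=
  Set.ext fun c ↦ (isRationalClass_iff_exists_ringChange c).trans
    ⟨fun ⟨x, hx⟩ ↦ ⟨x, hx⟩, fun ⟨x, hx⟩ ↦ ⟨x, hx⟩⟩

/-! ### `ℚ`-linearity and injectivity of `Hᵏ(Y; ℚ) → Hᵏ(Y; ℂ)` -/

/-- **`ι` is `ℚ`-linear**: `ι(q • x) = q • ι(x)` for `q ∈ ℚ` (on cocycles, `(ℚ ↪ ℂ) ∘ (q ζ) =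
q ((ℚ ↪ ℂ) ∘ ζ)`). [folklore] -/
theorem ringChange_ratCast_smul (q : ℚ) (x : singularCohomology ℚ ℚ Y k) :
    singularCohomology.ringChange (algebraMap ℚ ℂ) Y k (q • x) =
      (q : ℂ) • singularCohomology.ringChange (algebraMap ℚ ℂ) Y k x := by
  induction x using singularCohomology_induction_on with
  | h ζ =>
    rw [← map_smul, singularCohomology.ringChange_π, singularCohomology.ringChange_π, ← map_smul]
    congr 1
    refine coFn_injective ?_
    have h1 : coFn (q • ζ) = q • coFn ζ := (iCocycles ℚ ℚ Y k).hom.map_smul q ζ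
    have h2 : coFn ((q : ℂ) • cocyclesRingChange (algebraMap ℚ ℂ) k ζ) =
        (q : ℂ) • coFn (cocyclesRingChange (algebraMap ℚ ℂ) k ζ) :=
      (iCocycles ℂ ℂ Y k).hom.map_smul (q : ℂ) _
    rw [coFn_cocyclesRingChange, h1, h2, coFn_cocyclesRingChange]
    funext σ
    simp only [Function.comp_apply, Pi.smul_apply, smul_eq_mul, map_mul, eq_ratCast]

/-- `ι` commutes with finite `ℚ`-linear combinations: `ι(∑ qⱼ xⱼ) = ∑ qⱼ ι(xⱼ)`. [folklore] -/
theorem ringChange_sum_smul {ι : Type*} (s : Finset ι) (q : ι → ℚ)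
    (x : ι → singularCohomology ℚ ℚ Y k) :
    singularCohomology.ringChange (algebraMap ℚ ℂ) Y k (∑ j ∈ s, q j • x j) =
      ∑ j ∈ s, ((q j : ℚ) : ℂ) • singularCohomology.ringChange (algebraMap ℚ ℂ) Y k (x j) := by
  rw [map_sum]
  exact Finset.sum_congr rfl fun j _ ↦ ringChange_ratCast_smul (q j) (x j)

/-- **`Hᵏ(Y; ℚ) → Hᵏ(Y; ℂ)` is injective**: `ι(x) = 0 ↔ x = 0`, for every topological space `Y` and
every `k`. (`→`, on cochains: if `(ℚ ↪ ℂ) ∘ ζ = δw` for a `ℂ`-valued cochain `w`, choose a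
`ℚ`-linear retraction `ρ : ℂ → ℚ` of the inclusion; then `ζ = ρ ∘ (ℚ ↪ ℂ) ∘ ζ = ρ ∘ δw = δ(ρ ∘ w)`
by `coboundary_comp_addMonoidHom`. In degree `0` there are no coboundaries.) Over a field this is
also immediate from `Hᵏ(Y; F) = Hom(Hₖ(Y), F)` (Hatcher, Thm. 3.2).
[cite: HatcherAT2002, §3.1 Thm. 3.2 and p. 198] -/
theorem ringChange_rat_eq_zero_iff (x : singularCohomology ℚ ℚ Y k) :
    singularCohomology.ringChange (algebraMap ℚ ℂ) Y k x = 0 ↔ x = 0 := by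
  refine ⟨fun hx ↦ ?_, fun hx ↦ by rw [hx, map_zero]⟩
  -- a `ℚ`-linear retraction of `ℚ ↪ ℂ`
  obtain ⟨ρ, hρ⟩ : ∃ ρ : ℂ →ₗ[ℚ] ℚ, ∀ q : ℚ, ρ (algebraMap ℚ ℂ q) = q := by
    refine ⟨(Algebra.linearMap ℚ ℂ).leftInverse, fun q ↦ ?_⟩
    rw [show algebraMap ℚ ℂ q = Algebra.linearMap ℚ ℂ q from rfl,
      LinearMap.leftInverse_apply_of_inj]
    exact LinearMap.ker_eq_bot.2 (algebraMap ℚ ℂ).injective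
  have hρf : ∀ φ : SingularSimplex Y k → ℚ, ρ.toAddMonoidHom ∘ ((algebraMap ℚ ℂ) ∘ φ) = φ :=
    fun φ ↦ funext fun σ ↦ hρ (φ σ)
  induction x using singularCohomology_induction_on with
  | h ζ =>
    rw [singularCohomology.ringChange_π, singularCohomology.π_eq_zero_iff_exists] at hx
    obtain ⟨w, hw⟩ := hx
    rw [← coFn_eq, coFn_cocyclesRingChange] at hw
    cases k with
    | zero =>
      -- no coboundaries in degree `0`: `(ℚ ↪ ℂ) ∘ ζ = 0`, so `ζ = 0`
      rw [d_prev_zero_eq_zero] at hw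
      have hζ : coFn ζ = 0 := by
        rw [← hρf (coFn ζ), ← hw]
        funext σ
        exact map_zero ρ
      rw [show ζ = 0 from coFn_injective (hζ.trans coFn_zero.symm), map_zero]
    | succ m =>
      obtain ⟨w', hw'⟩ := (exists_d_prev_succ_iff _).1 ⟨w, hw⟩
      rw [singularCohomology.π_eq_zero_iff_exists]
      refine (exists_d_prev_succ_iff _).2 ⟨ρ.toAddMonoidHom ∘ w', ?_⟩
      rw [coboundary_comp_addMonoidHom, hw', hρf, coFn_eq]

/-- **`Hᵏ(Y; ℚ) → Hᵏ(Y; ℂ)` is injective.** [cite: HatcherAT2002, §3.1 Thm. 3.2 and p. 198] -/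
theorem ringChange_rat_injective :
    Function.Injective (singularCohomology.ringChange (algebraMap ℚ ℂ) Y k) :=
  (injective_iff_map_eq_zero _).2 fun x ↦ (ringChange_rat_eq_zero_iff x).1

/-- Hence `ι(x) = ι(y) ↔ x = y`. [cite: HatcherAT2002, §3.1 Thm. 3.2 and p. 198] -/
theorem ringChange_rat_eq_iff (x y : singularCohomology ℚ ℚ Y k) :
    singularCohomology.ringChange (algebraMap ℚ ℂ) Y k x =
        singularCohomology.ringChange (algebraMap ℚ ℂ) Y k y ↔ x = y :=
  ringChange_rat_injective.eq_iff

/-! ### `Hᵏ(Y; ℚ) ⊗ ℂ → Hᵏ(Y; ℂ)` is injective: independence and spans -/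

/-- **A family `x : ι → Hᵏ(Y; ℚ)` is `ℚ`-linearly independent iff the family of complexified
classes `ι ∘ x` is `ℂ`-linearly independent** — the injectivity of `Hᵏ(Y; ℚ) ⊗_ℚ ℂ → Hᵏ(Y; ℂ)`
(Voisin I, §7.1.1), for every topological space `Y`, degree `k` and index type. (`←`: a rational
relation is a complex relation, and `ι` is `ℚ`-linear and injective. `→`: on finite subfamilies,
`linearIndependent_of_isRationalClass` — the `ι(xⱼ)` are rational classes and a rational relation
among them is a relation among the `xⱼ` by injectivity of `ι`.)
[cite: VoisinHodgeI2002, §7.1.1] [cite: HatcherAT2002, §3.1 Thm. 3.2 and p. 198] -/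
theorem linearIndependent_ringChange_iff {ι : Type*} (x : ι → singularCohomology ℚ ℚ Y k) :
    LinearIndependent ℂ (fun j ↦ singularCohomology.ringChange (algebraMap ℚ ℂ) Y k (x j)) ↔
      LinearIndependent ℚ x := by
  classical
  constructor
  · intro h
    rw [linearIndependent_iff'] at h ⊢
    intro s q hq j hj
    have hq' : ∑ i ∈ s, ((q i : ℚ) : ℂ) •
        singularCohomology.ringChange (algebraMap ℚ ℂ) Y k (x i) = 0 := by
      rw [← ringChange_sum_smul, hq, map_zero]
    exact_mod_cast h s (fun i ↦ ((q i : ℚ) : ℂ)) hq' j hj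
  · intro h
    rw [linearIndependent_iff_finset_linearIndependent]
    intro s
    refine linearIndependent_of_isRationalClass (fun j ↦ isRationalClass_ringChange _) fun q hq ↦ ?_
    have h1 : singularCohomology.ringChange (algebraMap ℚ ℂ) Y k (∑ j : s, q j • x j) = 0 := by
      rw [ringChange_sum_smul]
      exact hq
    rw [ringChange_rat_eq_zero_iff] at h1
    exact funext fun j ↦
      Fintype.linearIndependent_iff.1 (h.comp (Subtype.val : s → ι) Subtype.val_injective) q h1 j

/-- The image under `ι` of the `ℚ`-span of a set `S ⊆ Hᵏ(Y; ℚ)` lies in the `ℂ`-span of `ι(S)`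
(`ι` is additive and `ℚ`-homogeneous). [folklore] -/
theorem ringChange_mem_span_image_of_mem_span {S : Set (singularCohomology ℚ ℚ Y k)}
    {x : singularCohomology ℚ ℚ Y k} (hx : x ∈ Submodule.span ℚ S) :
    singularCohomology.ringChange (algebraMap ℚ ℂ) Y k x ∈
      Submodule.span ℂ (singularCohomology.ringChange (algebraMap ℚ ℂ) Y k '' S) := by
  induction hx using Submodule.span_induction with
  | mem y hy => exact Submodule.subset_span ⟨y, hy, rfl⟩
  | zero => rw [map_zero]; exact Submodule.zero_mem _
  | add y z _ _ hy hz => rw [map_add]; exact Submodule.add_mem _ hy hz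
  | smul q y _ hy => rw [ringChange_ratCast_smul]; exact Submodule.smul_mem _ _ hy

/-- `ℂ · ι(ℚ · S) = ℂ · ι(S)` for `S ⊆ Hᵏ(Y; ℚ)`. [folklore] -/
theorem span_ringChange_image_span (S : Set (singularCohomology ℚ ℚ Y k)) :
    Submodule.span ℂ (singularCohomology.ringChange (algebraMap ℚ ℂ) Y k ''
        (Submodule.span ℚ S : Set (singularCohomology ℚ ℚ Y k))) =
      Submodule.span ℂ (singularCohomology.ringChange (algebraMap ℚ ℂ) Y k '' S) := by
  refine le_antisymm (Submodule.span_le.2 ?_) (Submodule.span_mono (Set.image_mono ?_))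
  · rintro _ ⟨x, hx, rfl⟩
    exact ringChange_mem_span_image_of_mem_span hx
  · exact Submodule.subset_span

/-- **Rational descent of linear relations.** For a `ℚ`-subspace `V ⊆ Hᵏ(Y; ℚ)` and `x ∈ Hᵏ(Y; ℚ)`:
`ι(x)` lies in the `ℂ`-span of `ι(V)` iff `x ∈ V` — i.e. `ℂ · ι(V) ∩ ι(Hᵏ(Y; ℚ)) = ι(V)`. (`→`:
otherwise `x` together with a `ℚ`-basis of `V` is `ℚ`-independent, hence `ℂ`-independent after `ι`
by `linearIndependent_ringChange_iff`, contradicting `ι(x) ∈ ℂ · ι(V)`.) This is the form in which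
"`Hᵏ(X, ℚ) ⊗ ℂ = Hᵏ(X, ℂ)`" (Voisin I, §7.1.1) transports statements about spans of algebraic
classes between `ℚ`- and `ℂ`-coefficients. [cite: VoisinHodgeI2002, §7.1.1] -/
theorem ringChange_mem_span_image_iff (V : Submodule ℚ (singularCohomology ℚ ℚ Y k))
    (x : singularCohomology ℚ ℚ Y k) :
    singularCohomology.ringChange (algebraMap ℚ ℂ) Y k x ∈
        Submodule.span ℂ (singularCohomology.ringChange (algebraMap ℚ ℂ) Y k ''
          (V : Set (singularCohomology ℚ ℚ Y k))) ↔ x ∈ V := by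
  refine ⟨fun h ↦ ?_, fun h ↦ Submodule.subset_span ⟨x, h, rfl⟩⟩
  by_contra hxV
  obtain ⟨T, -, hspan, hT⟩ :=
    exists_linearIndependent ℚ (V : Set (singularCohomology ℚ ℚ Y k))
  rw [Submodule.span_eq] at hspan
  rw [← hspan, span_ringChange_image_span, Set.image_eq_range] at h
  have hx' : x ∉ Submodule.span ℚ (Set.range ((↑) : T → singularCohomology ℚ ℚ Y k)) := by
    rwa [Subtype.range_coe, hspan]
  have hC : LinearIndependent ℂ (fun o : Option T ↦ Option.casesOn' o
      (singularCohomology.ringChange (algebraMap ℚ ℂ) Y k x)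
      (fun i : T ↦ singularCohomology.ringChange (algebraMap ℚ ℂ) Y k (i : _))) := by
    have := (linearIndependent_ringChange_iff _).2 (hT.option hx')
    convert this using 1
    funext o
    cases o <;> rfl
  exact (linearIndependent_option'.1 hC).2 h

end HodgeTheory

end Literature.AlgebraicGeometry.HodgeTheory

end
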